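import Mathlib
import HarnessLib
import Summits.PneNP.PneNP.Theorems.RamseyUncertifiablePaleySosRungCrossNormAux2

/-!
# Cross-matrix norm bounds from star codegrees — auxiliary file 3/3 (the master bound)

Helper file for the registered stub `stub_crossNormOfCodegrees` of crux stmt-PneNP-9817
(`Summit.PneNP.PneNP.Theses.RamseyUncertifiable.PaleySosRung`, line `weil-patch-transfer`).

It assembles the two term bounds of file 2 into the graph-free master inequality
`cn_bilinearBound` / `CrossNorm.abs_bilinear_le`: for weights `|τ(V,w)| ≤ 2^r`, any kernel `R` on
`a`-sets × `b`-sets with `R[V,W] = Π_{w ∈ W}(1 + τ(V,w)) - 1 + [V ∩ W ≠ ∅]` (`1 ≤ a, b ≤ r`), and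
codegrees `|Σ_{w ∉ V ∪ V'} τ(V,w)τ(V',w)| ≤ D` for all DISJOINT pairs of `a`-sets
(`1 ≤ D`, `√N ≤ D ≤ N`), one has `|Σ u_V v_W R[V,W]| ≤ √(C N^(a+b-1) D) ‖u‖ ‖v‖` for
`C ≥ (r+1)² 2^r K^r (r+1)`, `K = 1 + 4^r(2r+1)`. The expansion
`Π_{w ∈ W}(1 + τ) - 1 = Σ_{k=1}^{b} Σ_{W' ⊆ W, |W'| = k} Π_{W'} τ` (`prod_one_add_sub_one_eq`)
splits the form into the `b` terms `T_k N_k` and the term `E`. It also records the identity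
`cross_entry_eq` recognising the Meka–Potechin–Wigderson cross-matrix entries of a graph in this
shape.

References: R. Meka, A. Potechin, A. Wigderson, *Sum-of-squares lower bounds for planted
clique*, arXiv:1503.06447, §8.2; the linear algebra is folklore.
-/

set_option linter.dupNamespace false -- `Summit.PneNP.PneNP.…`: summit = sub-problem (D-0017)

namespace Summit.PneNP.PneNP.Theorems.PaleySosRungWeilPatch

namespace CrossNorm

open Finset

variable {α : Type*} [Fintype α] [DecidableEq α]

omit [Fintype α] [DecidableEq α] in
/-- **The expansion** `Π_{w ∈ W} (1 + t w) - 1 = Σ_{k < b} Σ_{W' ⊆ W, |W'| = k+1} Π_{w ∈ W'} t w`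
for `|W| = b` (`Finset.prod_one_add`, graded by cardinality). [folklore] -/
theorem prod_one_add_sub_one_eq (t : α → ℝ) (W : Finset α) (b : ℕ)
    (hW : W.card = b) :
    (∏ w ∈ W, (1 + t w)) - 1
      = ∑ k ∈ range b, ∑ W' ∈ powersetCard (k + 1) W, ∏ w ∈ W', t w := by
  rw [prod_one_add, sum_powerset, hW, sum_range_succ', powersetCard_zero, sum_singleton,
    prod_empty]
  ring

/-- **The `k`-th term, final form**: with the row-sum bound `cn_rowSumBound` fed into
`CrossNorm.abs_termK_le` and the constants collected by `CrossNorm.const_bound_termK`,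
`|Σ_V Σ_W u_V v_W Σ_{W' ⊆ W, |W'| = k} Π_{W'} τ(V,·)| ≤ √(2^r K^r (r+1) N^(a+b-1) D) ‖u‖ ‖v‖`
for `1 ≤ k ≤ b`. [folklore] -/
theorem abs_termK_le_final (τ : Finset α → α → ℝ) {r a b k : ℕ} (ha : 1 ≤ a) (har : a ≤ r)
    (hbr : b ≤ r) (hk1 : 1 ≤ k) (hkb : k ≤ b) {D : ℝ} (hD1 : 1 ≤ D)
    (hDN : D ≤ Fintype.card α) (hsqrt : Real.sqrt (Fintype.card α) ≤ D)
    (hτ : ∀ V w, |τ V w| ≤ (2 : ℝ) ^ r)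
    (hyp : ∀ V ∈ powersetCard a (univ : Finset α), ∀ V' ∈ powersetCard a (univ : Finset α),
      Disjoint V V' → |∑ w ∈ univ \ (V ∪ V'), τ V w * τ V' w| ≤ D)
    (u v : Finset α → ℝ) :
    |∑ V ∈ powersetCard a (univ : Finset α), ∑ W ∈ powersetCard b (univ : Finset α),
        u V * v W * ∑ W' ∈ powersetCard k W, ∏ w ∈ W', τ V w|
      ≤ Real.sqrt (2 ^ r * (1 + (4 : ℝ) ^ r * (2 * r + 1)) ^ r * (r + 1)
            * (Fintype.card α : ℝ) ^ (a + b - 1) * D)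
        * Real.sqrt (∑ V ∈ powersetCard a (univ : Finset α), u V ^ 2)
        * Real.sqrt (∑ W ∈ powersetCard b (univ : Finset α), v W ^ 2) := by
  have hD0 : 0 ≤ D := zero_le_one.trans hD1
  have hN0 : (0 : ℝ) ≤ Fintype.card α := Nat.cast_nonneg _
  have hK1 : (1 : ℝ) ≤ 1 + (4 : ℝ) ^ r * (2 * r + 1) := by
    have : (0 : ℝ) ≤ (4 : ℝ) ^ r * (2 * r + 1) := by positivity
    linarith
  have hK0 : (0 : ℝ) ≤ 1 + (4 : ℝ) ^ r * (2 * r + 1) := zero_le_one.trans hK1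
  have hrow : ∀ V ∈ powersetCard a (univ : Finset α), ∑ V' ∈ powersetCard a (univ : Finset α),
      |∑ W' ∈ powersetCard k (univ : Finset α), (∏ w ∈ W', τ V w) * (∏ w ∈ W', τ V' w)|
        ≤ (Fintype.card α : ℝ) ^ a * ((1 + (4 : ℝ) ^ r * (2 * r + 1)) * D) ^ k
          + a * (Fintype.card α : ℝ) ^ (a - 1)
            * ((1 + (4 : ℝ) ^ r * (2 * r + 1)) * Fintype.card α) ^ k :=
    fun V hV => row_sum_le τ a k r har hτ hD1 hDN hsqrt hyp V hV
  have h1 := abs_termK_le (powersetCard a univ) b k (fun V W' => ∏ w ∈ W', τ V w) u v hrow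
  have hρc := const_bound_termK (N := (Fintype.card α : ℝ)) hK1 hD1 hDN ha har hbr hk1 hkb
  refine h1.trans ?_
  set N : ℝ := (Fintype.card α : ℝ) with hN
  set K : ℝ := 1 + (4 : ℝ) ^ r * (2 * r + 1) with hK
  set ρ : ℝ := N ^ a * (K * D) ^ k + a * N ^ (a - 1) * (K * N) ^ k with hρ
  set U : ℝ := ∑ V ∈ powersetCard a (univ : Finset α), u V ^ 2 with hU
  set Vv : ℝ := ∑ W ∈ powersetCard b (univ : Finset α), v W ^ 2 with hVv
  have hρ0 : 0 ≤ ρ :=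
    add_nonneg (mul_nonneg (pow_nonneg hN0 _) (pow_nonneg (mul_nonneg hK0 hD0) _))
      (mul_nonneg (mul_nonneg (Nat.cast_nonneg _) (pow_nonneg hN0 _))
        (pow_nonneg (mul_nonneg hK0 hN0) _))
  have hc0 : 0 ≤ N ^ (b - k) * 2 ^ b := mul_nonneg (pow_nonneg hN0 _) (pow_nonneg zero_le_two _)
  calc Real.sqrt (ρ * U) * Real.sqrt (N ^ (b - k) * 2 ^ b * Vv)
      = Real.sqrt (ρ * (N ^ (b - k) * 2 ^ b)) * Real.sqrt U * Real.sqrt Vv := by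
        rw [Real.sqrt_mul hρ0, Real.sqrt_mul hc0, Real.sqrt_mul hρ0]; ring
    _ ≤ Real.sqrt (2 ^ r * K ^ r * (r + 1) * N ^ (a + b - 1) * D)
        * Real.sqrt U * Real.sqrt Vv :=
        mul_le_mul_of_nonneg_right (mul_le_mul_of_nonneg_right (Real.sqrt_le_sqrt hρc)
          (Real.sqrt_nonneg _)) (Real.sqrt_nonneg _)

/-- **The `E` term, final form**:
`|Σ_V Σ_W u_V v_W [V ∩ W ≠ ∅]| ≤ √(2^r K^r (r+1) N^(a+b-1) D) ‖u‖ ‖v‖`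
(`CrossNorm.abs_termE_le` and `CrossNorm.const_bound_termE`). [folklore] -/
theorem abs_termE_le_final {r a b : ℕ} (ha : 1 ≤ a) (har : a ≤ r) (hb : 1 ≤ b) (hbr : b ≤ r)
    {D : ℝ} (hD1 : 1 ≤ D) (hDN : D ≤ Fintype.card α) (u v : Finset α → ℝ) :
    |∑ V ∈ powersetCard a (univ : Finset α), ∑ W ∈ powersetCard b (univ : Finset α),
        u V * v W * (if Disjoint V W then 0 else 1)|
      ≤ Real.sqrt (2 ^ r * (1 + (4 : ℝ) ^ r * (2 * r + 1)) ^ r * (r + 1)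
            * (Fintype.card α : ℝ) ^ (a + b - 1) * D)
        * Real.sqrt (∑ V ∈ powersetCard a (univ : Finset α), u V ^ 2)
        * Real.sqrt (∑ W ∈ powersetCard b (univ : Finset α), v W ^ 2) := by
  have hN0 : (0 : ℝ) ≤ Fintype.card α := Nat.cast_nonneg _
  have hK1 : (1 : ℝ) ≤ 1 + (4 : ℝ) ^ r * (2 * r + 1) := by
    have : (0 : ℝ) ≤ (4 : ℝ) ^ r * (2 * r + 1) := by positivity
    linarith
  have h1 := abs_termE_le a b u v
  have hc := const_bound_termE (N := (Fintype.card α : ℝ)) hK1 hD1 hDN ha har hb hbr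
  refine h1.trans ?_
  set N : ℝ := (Fintype.card α : ℝ) with hN
  set K : ℝ := 1 + (4 : ℝ) ^ r * (2 * r + 1) with hK
  set U : ℝ := ∑ V ∈ powersetCard a (univ : Finset α), u V ^ 2 with hU
  set Vv : ℝ := ∑ W ∈ powersetCard b (univ : Finset α), v W ^ 2 with hVv
  have ha0 : 0 ≤ (a : ℝ) * N ^ (a - 1) := mul_nonneg (Nat.cast_nonneg _) (pow_nonneg hN0 _)
  have hb0 : 0 ≤ (b : ℝ) * N ^ (b - 1) := mul_nonneg (Nat.cast_nonneg _) (pow_nonneg hN0 _)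
  calc Real.sqrt (a * N ^ (a - 1) * U) * Real.sqrt (b * N ^ (b - 1) * Vv)
      = Real.sqrt ((a * N ^ (a - 1)) * (b * N ^ (b - 1))) * Real.sqrt U * Real.sqrt Vv := by
        rw [Real.sqrt_mul ha0, Real.sqrt_mul hb0, Real.sqrt_mul ha0]; ring
    _ ≤ Real.sqrt (2 ^ r * K ^ r * (r + 1) * N ^ (a + b - 1) * D)
        * Real.sqrt U * Real.sqrt Vv :=
        mul_le_mul_of_nonneg_right (mul_le_mul_of_nonneg_right (Real.sqrt_le_sqrt hc)
          (Real.sqrt_nonneg _)) (Real.sqrt_nonneg _)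

/-- **The graph-free master bound.** Let `τ(V,w)` be weights of modulus `≤ 2^r` and let `R` be
any kernel on `a`-sets × `b`-sets with `R[V,W] = Π_{w ∈ W} (1 + τ(V,w)) - 1 + [V ∩ W ≠ ∅]`
(`1 ≤ a, b ≤ r`). If `1 ≤ D`, `√N ≤ D ≤ N` and the codegrees `Σ_{w ∉ V ∪ V'} τ(V,w)τ(V',w)` of
all DISJOINT pairs of `a`-sets are at most `D` in modulus, then for all `u, v`,
`|Σ u_V v_W R[V,W]| ≤ √(C N^(a+b-1) D) ‖u‖ ‖v‖` for every `C ≥ (r+1)² 2^r K^r (r+1)`,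
`K = 1 + 4^r(2r+1)`: expand `R` by `CrossNorm.prod_one_add_sub_one_eq` into the `b` terms
`T_k N_k` (`k = 1..b`) plus `E`, and add up `abs_termK_le_final` and `abs_termE_le_final`.
[folklore] -/
theorem abs_bilinear_le (τ : Finset α → α → ℝ) (R : Finset α → Finset α → ℝ) {r a b : ℕ}
    (ha : 1 ≤ a) (har : a ≤ r) (hb : 1 ≤ b) (hbr : b ≤ r) {D C : ℝ} (hD1 : 1 ≤ D)
    (hDN : D ≤ Fintype.card α) (hsqrt : Real.sqrt (Fintype.card α) ≤ D)
    (hC : ((r : ℝ) + 1) ^ 2 * (2 ^ r * (1 + (4 : ℝ) ^ r * (2 * r + 1)) ^ r * (r + 1)) ≤ C)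
    (hτ : ∀ V w, |τ V w| ≤ (2 : ℝ) ^ r)
    (hR : ∀ V ∈ powersetCard a (univ : Finset α), ∀ W ∈ powersetCard b (univ : Finset α),
      R V W = (∏ w ∈ W, (1 + τ V w)) - 1 + (if Disjoint V W then 0 else 1))
    (hyp : ∀ V ∈ powersetCard a (univ : Finset α), ∀ V' ∈ powersetCard a (univ : Finset α),
      Disjoint V V' → |∑ w ∈ univ \ (V ∪ V'), τ V w * τ V' w| ≤ D)
    (u v : Finset α → ℝ) :
    |∑ V ∈ powersetCard a (univ : Finset α), ∑ W ∈ powersetCard b (univ : Finset α),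
        u V * v W * R V W|
      ≤ Real.sqrt (C * (Fintype.card α : ℝ) ^ (a + b - 1) * D)
        * Real.sqrt (∑ V ∈ powersetCard a (univ : Finset α), u V ^ 2)
        * Real.sqrt (∑ W ∈ powersetCard b (univ : Finset α), v W ^ 2) := by
  have hD0 : 0 ≤ D := zero_le_one.trans hD1
  have hN0 : (0 : ℝ) ≤ Fintype.card α := Nat.cast_nonneg _
  have hK : ∀ k ∈ range b,
      |∑ V ∈ powersetCard a (univ : Finset α), ∑ W ∈ powersetCard b (univ : Finset α),
        u V * v W * ∑ W' ∈ powersetCard (k + 1) W, ∏ w ∈ W', τ V w|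
      ≤ Real.sqrt (2 ^ r * (1 + (4 : ℝ) ^ r * (2 * r + 1)) ^ r * (r + 1)
            * (Fintype.card α : ℝ) ^ (a + b - 1) * D)
        * Real.sqrt (∑ V ∈ powersetCard a (univ : Finset α), u V ^ 2)
        * Real.sqrt (∑ W ∈ powersetCard b (univ : Finset α), v W ^ 2) := by
    intro k hk
    rw [mem_range] at hk
    exact abs_termK_le_final τ ha har hbr (Nat.succ_pos k) hk hD1 hDN hsqrt hτ hyp u v
  have hE := abs_termE_le_final (r := r) ha har hb hbr hD1 hDN u v
  -- the decomposition of `R`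
  have hexp : ∀ V ∈ powersetCard a (univ : Finset α), ∀ W ∈ powersetCard b (univ : Finset α),
      u V * v W * R V W
        = (∑ k ∈ range b, u V * v W * ∑ W' ∈ powersetCard (k + 1) W, ∏ w ∈ W', τ V w)
          + u V * v W * (if Disjoint V W then 0 else 1) := by
    intro V hV W hW
    rw [hR V hV W hW, prod_one_add_sub_one_eq (τ V) W b (mem_powersetCard_univ.1 hW), mul_add,
      mul_sum]
  have hB : ∑ V ∈ powersetCard a (univ : Finset α), ∑ W ∈ powersetCard b (univ : Finset α),
        u V * v W * R V W
      = (∑ k ∈ range b, ∑ V ∈ powersetCard a (univ : Finset α),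
          ∑ W ∈ powersetCard b (univ : Finset α),
            u V * v W * ∑ W' ∈ powersetCard (k + 1) W, ∏ w ∈ W', τ V w)
        + ∑ V ∈ powersetCard a (univ : Finset α), ∑ W ∈ powersetCard b (univ : Finset α),
            u V * v W * (if Disjoint V W then 0 else 1) := by
    rw [sum_congr rfl fun V hV => sum_congr rfl fun W hW => hexp V hV W hW]
    simp only [sum_add_distrib]
    congr 1
    exact (sum_congr rfl fun V _ => sum_comm).trans sum_comm
  -- abbreviate and sum up
  set S₀ : ℝ := Real.sqrt (2 ^ r * (1 + (4 : ℝ) ^ r * (2 * r + 1)) ^ r * (r + 1)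
            * (Fintype.card α : ℝ) ^ (a + b - 1) * D)
        * Real.sqrt (∑ V ∈ powersetCard a (univ : Finset α), u V ^ 2)
        * Real.sqrt (∑ W ∈ powersetCard b (univ : Finset α), v W ^ 2) with hS₀
  have hS0 : 0 ≤ S₀ := by positivity
  rw [hB]
  calc _ ≤ (∑ k ∈ range b, |∑ V ∈ powersetCard a (univ : Finset α),
          ∑ W ∈ powersetCard b (univ : Finset α),
            u V * v W * ∑ W' ∈ powersetCard (k + 1) W, ∏ w ∈ W', τ V w|)
        + |∑ V ∈ powersetCard a (univ : Finset α), ∑ W ∈ powersetCard b (univ : Finset α),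
            u V * v W * (if Disjoint V W then 0 else 1)| :=
        (abs_add_le _ _).trans (add_le_add (abs_sum_le_sum_abs _ _) le_rfl)
    _ ≤ (∑ _k ∈ range b, S₀) + S₀ := add_le_add (sum_le_sum hK) hE
    _ = ((b : ℝ) + 1) * S₀ := by rw [sum_const, card_range, nsmul_eq_mul]; ring
    _ ≤ ((r : ℝ) + 1) * S₀ := by
        refine mul_le_mul_of_nonneg_right ?_ hS0
        have : (b : ℝ) ≤ r := by exact_mod_cast hbr
        linarith
    _ = Real.sqrt (((r : ℝ) + 1) ^ 2 * (2 ^ r * (1 + (4 : ℝ) ^ r * (2 * r + 1)) ^ r * (r + 1))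
            * ((Fintype.card α : ℝ) ^ (a + b - 1) * D))
        * Real.sqrt (∑ V ∈ powersetCard a (univ : Finset α), u V ^ 2)
        * Real.sqrt (∑ W ∈ powersetCard b (univ : Finset α), v W ^ 2) := by
        rw [hS₀, mul_assoc (((r : ℝ) + 1) ^ 2), Real.sqrt_mul (sq_nonneg _),
          Real.sqrt_sq (by positivity)]
        ring_nf
    _ ≤ _ := by
        refine mul_le_mul_of_nonneg_right (mul_le_mul_of_nonneg_right (Real.sqrt_le_sqrt ?_)
          (Real.sqrt_nonneg _)) (Real.sqrt_nonneg _)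
        rw [mul_assoc C]
        exact mul_le_mul_of_nonneg_right hC (mul_nonneg (pow_nonneg hN0 _) hD0)

/-- **The cross-matrix entry as a product.** For a graph `G`, an `a`-set `V` (any finset, in
fact) and a `b`-set `W`, with `τ(V,w) = 2^a·[V ⊆ N(w)] - 1`:
`[V ∩ W = ∅]·(2^{ab}·[V × W ⊆ E(G)] - 1) = Π_{w ∈ W} (1 + τ(V,w)) - 1 + [V ∩ W ≠ ∅]`, because
`1 + τ(V,w) = 2^a·[V ⊆ N(w)]` and `V ⊆ N(w)` for all `w ∈ W` forces `V ∩ W = ∅` (no loops).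
These are the entries of the Meka–Potechin–Wigderson matrices `R_{a,b}` (arXiv:1503.06447, §8.2,
(25)). [folklore] -/
theorem cross_entry_eq (G : SimpleGraph α) [DecidableRel G.Adj] (a b : ℕ) (V W : Finset α)
    (hW : W.card = b) :
    (if Disjoint V W then
        (if ∀ x ∈ V, ∀ y ∈ W, G.Adj x y then (2 : ℝ) ^ (a * b) - 1 else -1)
      else 0)
      = (∏ w ∈ W, (1 + (if ∀ x ∈ V, G.Adj x w then (2 : ℝ) ^ a - 1 else -1))) - 1
        + (if Disjoint V W then 0 else 1) := by
  have hprod : (∏ w ∈ W, (1 + (if ∀ x ∈ V, G.Adj x w then (2 : ℝ) ^ a - 1 else -1)))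
      = if ∀ w ∈ W, ∀ x ∈ V, G.Adj x w then (2 : ℝ) ^ (a * b) else 0 := by
    have h1 : ∀ w ∈ W, (1 + (if ∀ x ∈ V, G.Adj x w then (2 : ℝ) ^ a - 1 else -1))
        = if ∀ x ∈ V, G.Adj x w then (2 : ℝ) ^ a else 0 := by
      intro w _
      split_ifs <;> ring
    rw [prod_congr rfl h1, prod_ite_zero, prod_const, hW, pow_mul]
    congr 1
  have hswap : (∀ w ∈ W, ∀ x ∈ V, G.Adj x w) ↔ (∀ x ∈ V, ∀ y ∈ W, G.Adj x y) :=
    ⟨fun h x hx y hy => h y hy x hx, fun h w hw x hx => h x hx w hw⟩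
  rw [hprod]
  by_cases hD : Disjoint V W
  · simp only [if_pos hD, hswap]
    split_ifs <;> ring
  · have hnot : ¬ (∀ w ∈ W, ∀ x ∈ V, G.Adj x w) := by
      intro h
      obtain ⟨z, hzV, hzW⟩ := not_disjoint_iff.1 hD
      exact G.irrefl (h z hzW z hzV)
    simp only [if_neg hD, if_neg hnot]
    ring


end CrossNorm

/-- **Registered helper stub `cn_bilinearBound`** (sub-goal of `stub_crossNormOfCodegrees` on
stmt-PneNP-9817): the graph-free master bilinear bound — a restatement of
`CrossNorm.abs_bilinear_le`. [folklore] -/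
theorem cn_bilinearBound : ∀ {α : Type*} [Fintype α] [DecidableEq α] (τ : Finset α → α → ℝ)
    (R : Finset α → Finset α → ℝ) (r a b : ℕ), 1 ≤ a → a ≤ r → 1 ≤ b → b ≤ r → ∀ (D C : ℝ),
    1 ≤ D → D ≤ Fintype.card α → Real.sqrt (Fintype.card α) ≤ D →
    ((r : ℝ) + 1) ^ 2 * (2 ^ r * (1 + (4 : ℝ) ^ r * (2 * r + 1)) ^ r * (r + 1)) ≤ C →
    (∀ V w, |τ V w| ≤ (2 : ℝ) ^ r) →
    (∀ V ∈ Finset.powersetCard a (Finset.univ : Finset α),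
      ∀ W ∈ Finset.powersetCard b (Finset.univ : Finset α),
        R V W = (∏ w ∈ W, (1 + τ V w)) - 1 + (if Disjoint V W then 0 else 1)) →
    (∀ V ∈ Finset.powersetCard a (Finset.univ : Finset α),
      ∀ V' ∈ Finset.powersetCard a (Finset.univ : Finset α), Disjoint V V' →
        |∑ w ∈ Finset.univ \ (V ∪ V'), τ V w * τ V' w| ≤ D) →
    ∀ (u v : Finset α → ℝ),
      |∑ V ∈ Finset.powersetCard a (Finset.univ : Finset α),
          ∑ W ∈ Finset.powersetCard b (Finset.univ : Finset α), u V * v W * R V W|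
        ≤ Real.sqrt (C * (Fintype.card α : ℝ) ^ (a + b - 1) * D)
          * Real.sqrt (∑ V ∈ Finset.powersetCard a (Finset.univ : Finset α), u V ^ 2)
          * Real.sqrt (∑ W ∈ Finset.powersetCard b (Finset.univ : Finset α), v W ^ 2) :=
  fun τ R _ _ _ ha har hb hbr _ _ hD1 hDN hsqrt hC hτ hR hyp u v =>
    CrossNorm.abs_bilinear_le τ R ha har hb hbr hD1 hDN hsqrt hC hτ hR hyp u v

end Summit.PneNP.PneNP.Theorems.PaleySosRungWeilPatch
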